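import Literature.NumberTheory.EllipticCurves.OrdinaryNewformDatumSelfDualTwist
import Literature.NumberTheory.EllipticCurves.BigGaloisRepSelmer
import Literature.NumberTheory.EllipticCurves.BDPAnticyclotomicPAdicLFunctionHigherWeight
import Literature.NumberTheory.EllipticCurves.ToricTwoVariablePAdicLFunction
import Literature.NumberTheory.EllipticCurves.Rank1Residual.Predicates
import Literature.NumberTheory.EllipticCurves.HeegnerPoints
import HarnessLib

/-!
# Keller–Yin (arXiv:2402.12781v2), Thm. 3.0.8 (label `IMC`, statement (IMC2)) — the Kolyvagin («⊇») divisibility of the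
# anticyclotomic Iwasawa main conjecture — FOR THE CRYSTALLINE HIDA MEMBER `g ∈ S_k(Γ₀(N/p))` of an elliptic curve `E/ℚ`
# at an odd multiplicative Eisenstein prime `p ∥ N`, read on the self-dual Tate twist in `𝓞_{ℂ_p}⟦T⟧`, up to a power of `p`
# (ONE named statement; UNREFEREED PREPRINT, tagged `_OPEN`)

Cell `bsd-eis` (home `run/shared/lean/pub/bsd-eis/`), typist seat `bsd-armP-typer-19034-T2` g0 (director-bsd (390)(4),
2026-08-29), for crux 4 `BSDpOnCellC` of item stmt-BirchSwinnertonDyer-19034: the crux line «telescope»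
(`Summits/BirchSwinnertonDyer/BirchSwinnertonDyer/Cruxes/BSDpOnCellC/Lines/telescope.lean`, stub `stub_memberDiv` = its
`MemberDivStatement`, K1) asks for exactly this typing; consumers `cruxlead-19034`, `bsd-idea-12`, host g34. The weight-`2`
sibling (the SAME theorem for the curve's own newform at a GOOD anomalous Eisenstein prime, read at the trivial character) is
`KellerYin2024/AnomalousAnticyclotomicMainConjecture.lean` (`thm308_imc2_bdpValue_goodLattice_OPEN`); the analytic companion
for the member (KY Thm. 2.2.2 at weight `k`) is `KellerYin2024/HigherWeightAnalyticInvariants.lean`; the typing pattern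
(member on the self-dual twist, reading map `b`, `XBig.charIdeal`, frame binders) is that of
`Castella2018/ErratumThm23UpperDivisibilitySelfDual.lean`. NOTHING IS PROVED HERE about any curve or form (D-0014: a named
`Prop`, no axiom, no `sorry`); the Birch–Swinnerton-Dyer conjecture is not advanced by typing a hypothesis; NEVER cite the
`Prop` below as a theorem — it transcribes an UNREFEREED preprint claim (arXiv:2402.12781v2, 30 Oct 2024; zbMATH «Preprint»,
no journal record as of 2026-08-29).

## Source, verbatim (TeX of record `HOME/lit/src/ky24-v2/main.tex`, line numbers `L…`; PDF pages from `HOME/lit/src/ky24-v2/PAGEMAP-v2.md`)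

* **Thm. 3.0.8** (label `IMC`, L1618–L1629, PDF p. 40; = arXiv v1 "Thm. 3.0.11"; restated in the Introduction as
  **Theorem A** (label `Gr imc`, L274–L278, p. 4: "Let `f ∈ S_k(Γ₀(N))` be a newform of weight `k = 2r` where `r` is odd and
  `p > 2` an ordinary Eisenstein prime not dividing `N`, and let `K` be an imaginary quadratic field satisfying the hypotheses
  in §0.1. Let `𝔛_f` be the Pontryagin dual of the unramified Selmer groups for `f` … and let `𝓛_f` be the corresponding BDP
  `p`-adic `L`-function. Then `𝔛_f` is `Λ`-torsion, and `Char(𝔛_f)Λ^{nr} = (𝓛_f)` as ideals in `Λ^{nr}`.")): "Assume `f` has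
  weight `2r` where `r` is odd. Assume that `p = v v̄` splits in `K` and `H⁰(K, ρ̄_f) = 0`. Then the following statements hold:
  … (IMC2) Both `H¹_{𝓕_nr}(K, 𝐓)` and `𝔛_f = H¹_{𝓕_nr}(K, M_f)^∨` are `Λ`-torsion, and the equality `Char_Λ(𝔛_f)Λ^{nr} = (𝓛_f)`
  holds in `Λ^{nr}`."
* **Its proof, the one-sided form** (L1633–L1643): "if `t > 0` or `N > 0`, the proof in [Cas17, Appendix A] would yield a new
  equivalence involving a fixed `p`-power: … (IMC2') Both `H¹_{𝓕_nr}(K, 𝐓)` and `𝔛_f` are `Λ`-torsion, and the divisibility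
  `Char_Λ(𝔛_f)Λ^{nr} ⊃ (p^{t+N} 𝓛_f)` holds in `Λ^{nr}`. … [Thm. 3.0.5] applied to the Kolyvagin system `κ^{Hg}_n = p^t κ_n` …
  shows the divisibility in (IMC1'). Hence we obtain (IMC2') from the equivalence." — THE SHAPE TYPED BELOW («⊇» up to `p^c`).
* **Rem. 3.0.9** (label `allowtor`, L1645–L1647): "As is explained in the beginning of §1.4, the above theorem still holds without
  assuming `H⁰(K, ρ̄_f) = 0`." **§1.4** (L1076): "Conjecture 1.2 (2) [of Kobayashi–Ota] (the anticyclotomic Main Conjecture for our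
  modular forms) is independent of the lattice `T_f`" (by Perrin-Riou's formula, [KobayashiOta, Prop. 2.9]); §3 standing (L1491):
  "Let `T` be an Galois stable lattice". **Rem. 3.0.7** (`rodd`, L1609–L1611): `r` odd is used only in Thm. 3.0.6 (`Koly`).
* **§1 standing** (L365–L381): "`f ∈ S_k(Γ₀(N))^{new}` a newform of weight `k = 2r ≥ 2` and level `N` with trivial nebentypus.
  Fix an odd prime `p ∤ N`. … `F` a finite extension of a completion of `ℚ(f)` at a chosen prime above `p` with ring of integers
  `𝒪` … `ρ_f : Gal(ℚ̄/ℚ) → Aut_F(V_f(1−r)) ≅ GL₂(F)` the self-dual Tate twist … It has determinant `χ`. … `K` an imaginary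
  quadratic field in which `p = v v̄` splits, with `v` the prime of `K` above `p` induced by `ι_p` … Heegner hypothesis: every
  prime `ℓ ∣ N` splits in `K`"; `Λ = 𝒪⟦Γ⟧ ≅ 𝒪⟦T⟧`, `T = γ − 1` (L385); §0.1 (L230): "`D_K` is odd and `≠ −3`"; §0.2 (L249):
  "`Λ^{nr} := Λ ⊗̂_{ℤ_p} ℤ_p^{nr}`, for `ℤ_p^{nr}` the completion of the ring of integers of the maximal unramified extension of `ℚ_p`".
* **§1.4, the Selmer group** (L1051–L1064): `H¹_{𝓕_nr}(K, M_f) = ker{H¹(K^Σ/K, M_f) → ∏_{w∈Σ, w∤p} H¹(I_w, M_f)^{G_w/I_w} ×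
  H¹(I_{v̄}, M_f)^{G_{v̄}/I_{v̄}}}` (unramified at `v̄` and away from `p`, NO condition at `v`); "One can similarly define the
  Greenberg Selmer groups for `f` by imposing triviality at `v̄`"; proof of Thm. 3.0.8 (L1631): "the equivalence is done with the
  Greenberg Selmer groups, but they generate the same characteristic ideals as the unramified Selmer group do."
* **Prop. 2.1.1** (L1378–L1384): "There exists an element `𝓛_f ∈ Λ^{nr}` characterized by …
  `𝓛_f(ξ̂) = Ω_p^{4n}/Ω_K^{4n} · 4Γ(n+k/2)Γ(n−k/2+1)ξ^{−1}(𝔑^{−1})/((2π)^{2n+1}(√D_K)^{2n−1}) · (1 − a_p(f)p^{−r}ξ_{𝔭̄}(p) +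
  ξ_{𝔭̄}(p²)p^{−1})² · L(f/K, ξ, k/2)`. Here and in the following `p`-adic units may be ignored in the expressions." ("proved in
  [CGLS, Thm. 2.1.1], using results from [CastellaHsieh]"; "the assumption `p ∤ (2k−1)!` can be directly removed").
* **§5.1 (a)–(d)** (L1735–L1743, p. 43) — THE MEMBER INSTANCE IS PRINTED: "for each integer `m > 0` we get (a) a newform `f_m` …
  `k_m > 2` and `k_m ≡ 2 (mod p−1)` and such that `a_p(f_m) ∈ 𝒪^×`; … (c) `ρ̄_f ≅ ρ̄_{f_m}` is reducible …; (d) `𝔛^S_{f_m}` is a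
  torsion `Λ`-module and `Char(𝔛^S_{f_m})Λ^{nr} = (𝓛^S_{f_m})` … (d) follows from Thm. 3.0.8 (IMC2) for good ordinary forms `f_m`
  in the previous sections … Note that by Thm. 3.0.6 we only know the Main Conjectures for a subfamily with weights
  `k_m ≡ 2 (mod 4)`." ([Skinner, §3.1]: the members are newforms of level `N/p` prime to `p`.)

## The object: the crystalline member, and the dictionary (tree vocabulary only; nothing re-declared)

Binders = those of «telescope»'s `MemberDivStatement` TOKEN FOR TOKEN, except that the Summits-side `CellC W p` is UNFOLDED to its
three usable conjuncts `2 < p`, `Red W p`, `W.HasMultiplicativeReductionAtPrime p` (as in `HigherWeightAnalyticInvariants.lean`;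
the analytic rank plays no role in Thm. 3.0.8) and the Summits-side inclusion `R1.unrToCpInt p : R₀ → 𝓞_{ℂ_p}` is the Literature
map `unrToInt` (`ToricTwoVariablePAdicLFunction.lean`; same underlying function `x ↦ ⟨x, _⟩`).

* KY's `f` ↦ THE MEMBER `g := D.g`, `D : Skinner2016.HidaCongruentForm W p 1` (`Skinner2016/HidaCongruentMembers.lean`; Skinner
  2016 §3.1 (a) = KY §5.1 (a)): a NEWFORM `g ∈ S_k(Γ₀(N/p))` (`D.isNewform`; `N = W.conductorNorm ℤ`, `p ∥ N` by
  `W.HasMultiplicativeReductionAtPrime p`, so the level `M = N/p` is prime to `p`: KY's "odd prime `p ∤ N`" for `f := g`), of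
  weight `k = D.k > 2` with `(p−1) ∣ k−2`, `ι`-ORDINARY (`D.norm_coeff_p`: `‖ι(a_p(g))‖_p = 1`, KY's "ordinary"), congruent to
  `f_E` at the good primes (`D.norm_coeff_sub_le`: `‖ι(a_ℓ(g)) − a_ℓ(E)‖_p ≤ p^{−1}`, `ℓ ∤ N`), with its integral ordinary datum
  `D.Δ : OrdinaryNewformDatum g p D.ι` over `𝒪 = padicCoeffIntegers D.ι` (= KY's `𝒪`: the integers of the completion of `ℚ(g)` at
  the prime induced by `ι`; `Λ_𝒪 = PowerSeries 𝒪`); `ι' : ℚ̄_p ≃ ℂ` extends `D.ι` (`∀ y, ι' (D.ι y) = y`: ONE pair of embeddings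
  `ι_∞, ι_p`, KY §1 L377). THE PARITY CLAUSE `2(p−1) ∣ k−2` (the stub's rider): with `k = 2r` it gives `(p−1) ∣ (r−1)`, hence
  `r` ODD (Thm. 3.0.8's "weight `2r` where `r` is odd"; = KY §5.1's "`k_m ≡ 2 (mod 4)`" within `k_m ≡ 2 (mod p−1)`) AND
  `ω^{1−r} = 𝟙`, so the self-dual twist `ρ̄_g(1−r)` has the same residual representation as `ρ̄_g`.
* "Eisenstein" ↦ rider (BN): `Red W p` (`E[p]` reducible) and the congruence give `tr ρ̄_{g,ι}(Frob_ℓ) ≡ a_ℓ(E)`,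
  `det = ℓ^{k−1} ≡ ℓ (mod p)` for all `ℓ ∤ Np`, so (Chebotarev, Brauer–Nesbitt) `ρ̄_g^{ss} ≅ E[p]^{ss} = 𝔽(φ) ⊕ 𝔽(φ^{−1}ω)` is
  REDUCIBLE — the prime of `𝒪` is Eisenstein for `g` (KY §0.1: "`φ, ψ = φ^{−1}ω`" after the self-dual twist; = KY §5.1 (c)).
  As in the analytic sibling this one-line consequence is carried INSIDE the named statement, not as a separate binder.
* `K` ↦ `IsImaginaryQuadratic K`, `SatisfiesHeegnerHypothesis N K` (every prime of `N` splits; inherited by the member's level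
  `N/p ∣ N`, `SatisfiesHeegnerHypothesis.of_dvd`), `Odd (discr K)` and `discr K < −4` (KY: `D_K` odd, `≠ −3`), `p` split
  (`((p).primesOver (𝓞 K)).ncard = 2`), `𝔭 ∣ p` of degree one INDUCED BY `ι'` (`k ∈ 𝔭 ↔ ‖ι'⁻¹(w(k))‖ < 1`) = KY's `v`, and
  `𝔭bar ∣ p`, `𝔭bar ≠ 𝔭` = KY's `v̄`; `κ` THE anticyclotomic `ℤ_p`-extension with topological generator `γ` (`1 + T ↔ γ`).
* `T`, `M_f` ↦ the SELF-DUAL lattice `D.Δ.selfDualRep = Δ.ρ ⊗ ε^{1−k/2}` (`det = ε` = KY's "determinant `χ`";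
  `OrdinaryNewformDatumSelfDualTwist.lean`, ruling T23-twist) and its big module over `Γ_K`; `𝔛_f` ↦
  `XBig κ (D.Δ.selfDualCofreeRepOver K) 𝔭bar ∅` (`BigGaloisRepSelmer.lean`): dual of the classes unramified at every `w ∤ p`
  (`Σ = ∅`), STRICT at `𝔭bar = v̄`, RELAXED at `𝔭 = v` — KY's GREENBERG variant ("imposing triviality at `v̄`"), which by their
  sentence L1631 has the same characteristic ideal as the `𝓕_nr`-group (flag `KY-Gr`); `Char_Λ(𝔛_f)` ↦
  `XBig.charIdeal κ (D.Δ.selfDualCofreeRepOver K) 𝔭bar ∅ : Ideal Λ_𝒪`. ANY `G_ℚ`-stable lattice is allowed in print (Rem. 3.0.9,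
  §1.4 L1076, L1491), in particular the datum's (flag `KY-lattice`); no `H⁰(K, ρ̄) = 0` binder.
* `𝓛_f ∈ Λ^{nr}` ↦ EVERY weight-`k` BDP frame `(ΩKg ≠ 0, ‖Ωpg‖ = 1, Lg ∈ R₀⟦T⟧)` of `g` AT `𝔭`:
  `IsBDPLFunctionWt ι' 𝔭 κ γ D.g ΩKg Ωpg Lg` (`BDPAnticyclotomicPAdicLFunctionHigherWeight.lean`: Castella–Hsieh Prop. 3.8 in
  Castella's normalisation = KY Prop. 2.1.1's display up to the `p`-adic units KY themselves ignore; flag `KY-frame-∀`: the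
  statement quantifies over all frames, as the erratum typing's `T23-frame-∀`; `R₀ = unrIntegers p = ℤ_p^{nr}`).
* `Λ^{nr}` ↦ the WIDER receptacle `𝓞_{ℂ_p}⟦T⟧` (flag `KY-receptacle`): `Λ_𝒪 → 𝓞_{ℂ_p}⟦T⟧` coefficientwise along a reading map
  `b : 𝒪 → 𝓞_{ℂ_p}` CHARACTERISED as the inclusion `𝒪 ⊂ ℚ̄_p ⊂ ℂ_p` (`(b y : ℂ_p) = algebraMap ℚ̄_p ℂ_p (toPadicAlgCl y)`), and
  `R₀⟦T⟧ → 𝓞_{ℂ_p}⟦T⟧` along `unrToInt`; an ideal membership in `Λ^{nr} = Λ_𝒪 ⊗̂ ℤ_p^{nr}` implies the one typed after this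
  extension of scalars, never conversely (typed ⊆ printed).
* CONCLUSION: `∃ c : ℕ, p^c · 𝓛_g ∈ Char_{Λ_𝒪}(𝔛_Gr(g)) · 𝓞_{ℂ_p}⟦T⟧` — (IMC2') with `c` for KY's `t + N` (and for the isogeny /
  period slack of the flags above); WEAKER than the printed equality `Char_Λ(𝔛_f)Λ^{nr} = (𝓛_f)` with `𝔛_f` torsion (if `𝔛` is
  not torsion the tree's `Module.charIdeal` makes the conclusion say nothing KY do not claim: they assert torsion). The instance
  binders `[TopologicalSpace Λ_𝒪] [ContinuousSMul Λ_𝒪 M]` are those of `BigGaloisRepSelmer` (discharged by the discrete topology,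
  `BigRepModule.instContinuousSMulOfDiscrete`, in every consumer).

## Riders a referee must check (nothing hidden; cf. the analytic sibling's list)

(BN) Brauer–Nesbitt for the member (above). (CHp) Castella–Hsieh's standing `p ∤ (2r−1)!` fails for every member (`k ≥ 2p`);
KY Prop. 2.1.1: "can be directly removed" — part of the preprint claim. (LV) KY Thm. 3.0.6 (`Koly`) imports Longo–Vigni's
Kolyvagin system of generalized Heegner cycles and Castella–Hsieh Prop. 3.9 / Thm. 4.9 at weight `2r`, `r` odd, with the `p^N`,
`p^t` corrections for the canonical lattice `T̃` (L1570–L1607) — preprint-grade at Eisenstein `p`. (Gr) `𝓕_nr` vs Greenberg at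
`v̄`: same characteristic ideal (KY L1631; KY Lemma 1.3.6). (lat) lattice independence (Rem. 3.0.9). (per) period / unit
normalisations are immaterial for an ideal statement up to `p^c` only if the discrepancy is a unit times a power of `p` — the
«Why it might fail» of the stub: a convention mismatch (which prime carries the multiplier, `Ω_g` vs `‖Ω_p‖ = 1`, `Σ = ∅`
primitivity) "by more than a `p`-power" would make this transcription, not KY's theorem, the culprit. (a′) KY/[Kri16]-type
level riders (`N > 4`) are not binders (none is printed in Thm. 3.0.8).

## What is NOT here

No bridge to the Summits stub (it is the prover's: `CellC W p` gives `2 < p`, `Red W p`, multiplicative reduction —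
`Theorems/EisensteinPrimesBSDpOnCellCMemberInvariantsOfAnacongWt.lean` `two_lt_of_cellC` ∕ `red_of_cellC` ∕ `mult_of_cellC` — and
`R1.unrToCpInt p` has the same values as `unrToInt`); no (IMC1), no equality, no torsion clause, no existence of the member or of
its frame (Hida 1986 / Castella 2020 Thm. 2.11 / Castella–Hsieh Def. 3.7: other files); no KLZ17. One `def … : Prop`; no lemma is
claimed.

## References

* [KellerYin2024] T. Keller, M. Yin, *On the anticyclotomic Iwasawa theory of newforms at Eisenstein primes of semistable
  reduction*, arXiv:2402.12781v2 (30 Oct 2024), UNREFEREED: Thm. 3.0.8 (IMC2) p. 40 (TeX L1618–L1643), Rem. 3.0.9 (L1645–L1647),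
  Rem. 3.0.7, Thm. A (p. 4, L274–L280), §0.1 (L228–L230), §1 standing (L365–L385), §1.4 (L1051–L1083), Prop. 2.1.1 (L1378–L1386),
  §5.1 (a)–(d) (p. 43, L1735–L1743).
* [CastellaGrossiLeeSkinner2022] Invent. Math. 227 (2022): Thm. 2.1.1 (the BDP element `𝓛_f`), Prop. 4.2.1, Thm. 4.1.1 (shape of
  the Kolyvagin argument KY generalise). [Castella2017JLMS] App. A (the `p`-power equivalence (IMC1') ⇔ (IMC2')).
* [CastellaHsieh2018] Math. Ann. 370 (2018): §1 (self-dual twist `V_f(r)`), §3.3 Def. 3.7 / Prop. 3.8 (the weight-`2r` measure),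
  Prop. 3.9, Thm. 4.9, (7.2). [Skinner2016PacificMC] §2.6, §3.1 (a) (the member). [KobayashiOta] Prop. 2.9 (lattice independence,
  as cited by KY). [Castella2018Erratum] §2 (the member typing on the self-dual twist; tree `ErratumThm23UpperDivisibilitySelfDual`).
-/

noncomputable section

open scoped Classical

open WeierstrassCurve NumberField IsDedekindDomain Field PowerSeries
  Literature.NumberTheory.EllipticCurves Literature.NumberTheory.EllipticCurves.ModularForms
  Literature.NumberTheory.EllipticCurves.Rank1Residual Literature.NumberTheory.EllipticCurves.GreenbergSelmer
  Literature.NumberTheory.EllipticCurves.BigGaloisRep Literature.NumberTheory.GaloisRepresentations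

namespace Literature.NumberTheory.EllipticCurves.KellerYin2024

/-- **OPEN HYPOTHESIS — UNREFEREED PREPRINT (Keller–Yin, arXiv:2402.12781v2, 30 Oct 2024), Theorem 3.0.8 (label `IMC`,
statement (IMC2), PDF p. 40; = v1 "Thm. 3.0.11"; Introduction Thm. A), in its one-sided printed form (IMC2') «`Char_Λ(𝔛_f)Λ^{nr} ⊃
(p^{t+N} 𝓛_f)`», FOR `f :=` THE CRYSTALLINE HIDA MEMBER `g = D.g ∈ S_k(Γ₀(N/p))` of an elliptic curve `E/ℚ` at an odd
multiplicative Eisenstein prime `p ∥ N` (congruence level `m = 1`), ON THE SELF-DUAL TATE TWIST, read in `𝓞_{ℂ_p}⟦T⟧`: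
`∃ c, p^c · 𝓛_𝔭(g) ∈ Char_{Λ_𝒪}(𝔛_{𝔭̄}(g)) · 𝓞_{ℂ_p}⟦T⟧`.** KY Thm. 3.0.8 verbatim: "Assume `f` has weight `2r` where `r` is
odd. Assume that `p = v v̄` splits in `K` and `H⁰(K, ρ̄_f) = 0` [removed by Rem. 3.0.9]. Then … (IMC2) Both `H¹_{𝓕_nr}(K, 𝐓)` and
`𝔛_f = H¹_{𝓕_nr}(K, M_f)^∨` are `Λ`-torsion, and the equality `Char_Λ(𝔛_f)Λ^{nr} = (𝓛_f)` holds in `Λ^{nr}`", under the §1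
standing "`f ∈ S_k(Γ₀(N))^{new}`, `k = 2r ≥ 2`, trivial nebentypus, odd prime `p ∤ N` [ordinary: Thm. A], `ρ_f` the self-dual
Tate twist, `K` imaginary quadratic, `p = v v̄` split, `v` induced by `ι_p`, every `ℓ ∣ N` splits in `K`", §0.1 "`D_K` odd, `≠ −3`",
Eisenstein `ρ̄_f^{ss} = 𝔽(φ) ⊕ 𝔽(φ^{−1}ω)`; KY apply it to exactly these members in §5.1 (a)–(d) (p. 43). DICTIONARY (module
docstring "The object"): `W` globally minimal elliptic, `2 < p`, `Red W p`, `p ∥ N` (`CellC` of the crux unfolded); `N = N_W`;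
`K` with (Heeg) for `N`, `D_K` odd `< −4`; `κ` anticyclotomic, `γ`; `𝔭 ∣ p` of degree one induced by `ι'`, `𝔭bar ≠ 𝔭` over `p`,
`p` split; the member `D : Skinner2016.HidaCongruentForm W p 1` (newform of level `N/p`, weight `k > 2`, `(p−1) ∣ k−2`,
`ι`-ordinary, congruent to `f_E` mod `p`, datum `D.Δ`) with `ι' ∘ D.ι = id` and THE PARITY CLAUSE `2(p−1) ∣ k−2` (⟹ `r = k/2` odd
and `ω^{1−r} = 𝟙`); the reading map `b : 𝒪 → 𝓞_{ℂ_p}` characterised as the inclusion; a weight-`k` BDP frame `(ΩKg ≠ 0,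
‖Ωpg‖ = 1, Lg ∈ R₀⟦T⟧)` at `𝔭`, `IsBDPLFunctionWt ι' 𝔭 κ γ D.g ΩKg Ωpg Lg` (= KY Prop. 2.1.1 up to `p`-adic units); `𝔛_f` =
`XBig κ (D.Δ.selfDualCofreeRepOver K) 𝔭bar ∅` (strict at `𝔭bar = v̄`, relaxed at `𝔭 = v`, unramified elsewhere: KY's Greenberg
variant, same characteristic ideal as `𝓕_nr` by KY L1631); receptacle `𝓞_{ℂ_p}⟦T⟧ ⊇ Λ^{nr}` via `b` and `unrToInt`. Flags
`KY-Gr`, `KY-lattice`, `KY-frame-∀`, `KY-receptacle`, riders (BN), (CHp), (LV), (Gr), (lat), (per): module docstring. Binders =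
«telescope» `MemberDivStatement` (crux 4 `BSDpOnCellC`, stmt-19034) with `CellC` unfolded and `R1.unrToCpInt p` ↦ `unrToInt`.
WEAKER than print (one divisibility, `∃ c`, scalars extended), never stronger. Named statement (D-0014): nothing about any curve
or form is asserted; BSD is not proved by typing; NEVER cite this `Prop` as a theorem — a result using it is conditional on an
unrefereed claim. [claim: KellerYin2024, status: under-review]
[cite: KellerYin2024, Thm. 3.0.8 (IMC2) and its proof (IMC2'), Rem. 3.0.9, Rem. 3.0.7, Thm. A, §1 standing, §1.4, Prop. 2.1.1, §5.1 (a)–(d) (arXiv:2402.12781v2 pp. 4, 40, 43; TeX L274–L280, L365–L385, L1051–L1083, L1378–L1386, L1618–L1647, L1735–L1743)]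
[cite: CastellaGrossiLeeSkinner2022, Thm. 2.1.1 and Prop. 4.2.1 (arXiv:2008.02571) (the BDP element and the (IMC1) ⇔ (IMC2) equivalence KY generalise; shape only)]
[cite: CastellaHsieh2018, §1 (p. 1) and §3.3 Def. 3.7, Prop. 3.8 (the self-dual twist and the weight-2r measure; shape only)]
[cite: Skinner2016PacificMC, §2.6 and §3.1 (a) (the member)]
[cite: Castella2018Erratum, §2 (p. 2) (member typing on the self-dual Tate twist; shape only, nothing asserted)] -/
def thm308_imc2_hidaMember_dvd_OPEN : Prop :=
  ∀ (W : WeierstrassCurve ℚ) [W.IsElliptic] [W.IsGloballyMinimal] (p : ℕ) [Fact p.Prime],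
    2 < p → Red W p → W.HasMultiplicativeReductionAtPrime p →
    ∀ (N : ℕ) [NeZero N] (K : Type) [Field K] [NumberField K],
      W.conductorNorm ℤ = N →
      IsImaginaryQuadratic K → NumberField.discr K < -4 → SatisfiesHeegnerHypothesis N K →
      Odd (NumberField.discr K) →
      ∀ (κ : ZpExtension K p), κ.IsAnticyclotomic →
        ∀ (γ : Field.absoluteGaloisGroup K) [Fact (κ.IsTopGenerator γ)]
          (𝔭 : HeightOneSpectrum (𝓞 K)), ((p : ℕ) : 𝓞 K) ∈ 𝔭.asIdeal →
          𝔭.asIdeal.ramificationIdx (𝓞 ℚ) = 1 → 𝔭.asIdeal.inertiaDeg (𝓞 ℚ) = 1 →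
          ∀ (𝔭bar : HeightOneSpectrum (𝓞 K)), ((p : ℕ) : 𝓞 K) ∈ 𝔭bar.asIdeal → 𝔭bar ≠ 𝔭 →
            ((Ideal.span {(p : ℤ)}).primesOver (𝓞 K)).ncard = 2 →
          ∀ (ι' : PadicAlgCl p ≃+* ℂ),
            (∀ (w : InfinitePlace K) (k : 𝓞 K), k ∈ 𝔭.asIdeal ↔ ‖ι'.symm (w.embedding (k : K))‖ < 1) →
          ∀ (D : Skinner2016.HidaCongruentForm W p 1),
            (∀ y : coeffField D.g, ι' (D.ι y) = (y : ℂ)) → 2 * ((p : ℤ) - 1) ∣ D.k - 2 →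
            ∀ (b : GreenbergSelmer.padicCoeffIntegers D.ι →+* 𝓞_ℂ_[p]),
              (∀ y, ((b y : 𝓞_ℂ_[p]) : ℂ_[p]) =
                algebraMap (PadicAlgCl p) ℂ_[p] (GreenbergSelmer.padicCoeffIntegers.toPadicAlgCl D.ι y)) →
            ∀ (ΩKg : ℂ) (Ωpg : ℂ_[p]) (Lg : UnrSeries p), ΩKg ≠ 0 → ‖Ωpg‖ = 1 →
              IsBDPLFunctionWt ι' 𝔭 κ γ D.g ΩKg Ωpg Lg →
            ∀ [TopologicalSpace (PowerSeries (GreenbergSelmer.padicCoeffIntegers D.ι))]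
              [ContinuousSMul (PowerSeries (GreenbergSelmer.padicCoeffIntegers D.ι))
                (BigRepModule (GreenbergSelmer.padicCoeffIntegers D.ι) p
                  (Cofree D.Δ.selfDualRep (GreenbergSelmer.padicCoeffField D.ι)))],
              ∃ c : ℕ, PowerSeries.C ((p : 𝓞_ℂ_[p]) ^ c) * PowerSeries.map unrToInt Lg ∈
                (XBig.charIdeal κ (D.Δ.selfDualCofreeRepOver K) 𝔭bar
                  (∅ : Set (HeightOneSpectrum (𝓞 K)))).map (PowerSeries.map b)

/-- **OPEN HYPOTHESIS — UNREFEREED PREPRINT (Keller–Yin, arXiv:2402.12781v2), Theorem 3.0.8 (IMC2), THE TORSION CLAUSE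
(PDF p. 40; = v1 "Thm. 3.0.11", p. 21 L35–38: «Both `H¹_{𝓕_nr}(K, 𝐓)` and `𝔛_f = H¹_{𝓕_nr}(K, M_f)^∨` are `Λ`-torsion, and the
equality `Char_Λ(𝔛_f)Λ^{nr} = (𝓛_f)` holds in `Λ^{nr}`»; kept in the one-sided form (IMC2') of its proof: «Both `H¹_{𝓕_nr}(K, 𝐓)` and
`𝔛_f` are `Λ`-torsion, and the divisibility …»), FOR `f :=` THE CRYSTALLINE HIDA MEMBER `g = D.g ∈ S_k(Γ₀(N/p))` of an elliptic curve
`E/ℚ` at an odd multiplicative Eisenstein prime `p ∥ N`, ON THE SELF-DUAL TATE TWIST — exactly as KY apply it to these members in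
§5.1 (d) (v2 p. 43; v1 p. 23 L28: «`𝔛^S_f(f_m)` is a torsion `Λ`-module and `Char(𝔛^S_{f_m}) = (𝓛^S_{f_m})`»): the member's big
dual Selmer module `XBig κ (D.Δ.selfDualCofreeRepOver K) 𝔭bar ∅` (strict at `𝔭bar = v̄`, relaxed at `𝔭 = v`, unramified
elsewhere — the object of the sibling `thm308_imc2_hidaMember_dvd_OPEN`) is `Λ_𝒪 = PowerSeries 𝒪`-TORSION, for every admissible
topology. BINDERS = those of `thm308_imc2_hidaMember_dvd_OPEN` TOKEN FOR TOKEN (same dictionary and flags `KY-Gr`, `KY-lattice`,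
`KY-frame-∀` of this module's docstring; the reading map `b` and the weight-`k` BDP frame are irrelevant to this conclusion and
kept only so that the two clauses share one binder list); only the last three lines differ. WHY A SEPARATE NAME: the sibling
types the ideal membership (IMC2') only, whose `Module.charIdeal` is the junk value `⊤` off the torsion locus, so the torsion
clause of the SAME printed theorem is an independent typed statement; it is the one per-member arithmetic input of the «telescope»
line's member-control leaf (crux 4 `BSDpOnCellC`, stmt-BirchSwinnertonDyer-19034: ideator bsd-idea-12 g35
`Cruxes/BSDpOnCellC/Lines/telescopeK2reg.lean` `K2Reg.stub_memberTorsionKY` = THIS statement; consumed by name through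
`Summit.….Theorems.TelescopeK2MemberControlOfMod.memberControl_of_mod`, whose binder `hKY` is this text). WEAKER than print (one
clause; Hida member instance), never stronger. Named statement (D-0014): nothing about any curve or form is asserted; BSD is not
proved by typing; NEVER cite this `Prop` as a theorem — a result using it is conditional on an unrefereed claim.
[claim: KellerYin2024, status: under-review]
[cite: KellerYin2024, Thm. 3.0.8 (IMC2) torsion clause and proof (IMC2'), Rem. 3.0.9, Thm. A, §5.1 (d) (arXiv:2402.12781v2 pp. 4, 40, 43; v1 Thm. 3.0.11 p. 21 L27–L38, §5 p. 23 L28)]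
[cite: Skinner2016PacificMC, §2.6 and §3.1 (a) (the member)]
[cite: Castella2018Erratum, §2 (p. 2) (member typing on the self-dual Tate twist; shape only, nothing asserted)] -/
def thm308_imc2_hidaMember_isTorsion_OPEN : Prop :=
  ∀ (W : WeierstrassCurve ℚ) [W.IsElliptic] [W.IsGloballyMinimal] (p : ℕ) [Fact p.Prime],
    2 < p → Red W p → W.HasMultiplicativeReductionAtPrime p →
    ∀ (N : ℕ) [NeZero N] (K : Type) [Field K] [NumberField K],
      W.conductorNorm ℤ = N →
      IsImaginaryQuadratic K → NumberField.discr K < -4 → SatisfiesHeegnerHypothesis N K →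
      Odd (NumberField.discr K) →
      ∀ (κ : ZpExtension K p), κ.IsAnticyclotomic →
        ∀ (γ : Field.absoluteGaloisGroup K) [Fact (κ.IsTopGenerator γ)]
          (𝔭 : HeightOneSpectrum (𝓞 K)), ((p : ℕ) : 𝓞 K) ∈ 𝔭.asIdeal →
          𝔭.asIdeal.ramificationIdx (𝓞 ℚ) = 1 → 𝔭.asIdeal.inertiaDeg (𝓞 ℚ) = 1 →
          ∀ (𝔭bar : HeightOneSpectrum (𝓞 K)), ((p : ℕ) : 𝓞 K) ∈ 𝔭bar.asIdeal → 𝔭bar ≠ 𝔭 →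
            ((Ideal.span {(p : ℤ)}).primesOver (𝓞 K)).ncard = 2 →
          ∀ (ι' : PadicAlgCl p ≃+* ℂ),
            (∀ (w : InfinitePlace K) (k : 𝓞 K), k ∈ 𝔭.asIdeal ↔ ‖ι'.symm (w.embedding (k : K))‖ < 1) →
          ∀ (D : Skinner2016.HidaCongruentForm W p 1),
            (∀ y : coeffField D.g, ι' (D.ι y) = (y : ℂ)) → 2 * ((p : ℤ) - 1) ∣ D.k - 2 →
            ∀ (b : GreenbergSelmer.padicCoeffIntegers D.ι →+* 𝓞_ℂ_[p]),
              (∀ y, ((b y : 𝓞_ℂ_[p]) : ℂ_[p]) =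
                algebraMap (PadicAlgCl p) ℂ_[p] (GreenbergSelmer.padicCoeffIntegers.toPadicAlgCl D.ι y)) →
            ∀ (ΩKg : ℂ) (Ωpg : ℂ_[p]) (Lg : UnrSeries p), ΩKg ≠ 0 → ‖Ωpg‖ = 1 →
              IsBDPLFunctionWt ι' 𝔭 κ γ D.g ΩKg Ωpg Lg →
            ∀ [TopologicalSpace (PowerSeries (GreenbergSelmer.padicCoeffIntegers D.ι))]
              [ContinuousSMul (PowerSeries (GreenbergSelmer.padicCoeffIntegers D.ι))
                (BigRepModule (GreenbergSelmer.padicCoeffIntegers D.ι) p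
                  (Cofree D.Δ.selfDualRep (GreenbergSelmer.padicCoeffField D.ι)))],
              Module.IsTorsion (PowerSeries (GreenbergSelmer.padicCoeffIntegers D.ι))
                (XBig κ (D.Δ.selfDualCofreeRepOver K) 𝔭bar (∅ : Set (HeightOneSpectrum (𝓞 K))))

end Literature.NumberTheory.EllipticCurves.KellerYin2024

end
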